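import Summits.HubbardSuperconductivity.HubbardSuperconductivity.Theorems.AnisotropyChordInsertionEntropyJastrowResampling

/-!
# Route `AnisotropyChord` / H0 rotor rung: the RESAMPLING ROUTE for a general Jastrow kernel — product bound,
# Jensen + energy floor, the soft `L¹` screening bound, and Onsager's lemma (kernel-generic port of theory seat
# `hubbard-h0-rotor-theory-1`, Sketch9 Part P (sheet half) and `sheetEnergyFloor_of_PSD`, memo ROTOR-THEORY-9 §135(t))

For an even kernel `W ≥ 0` with `W 0 = 0` on a finite abelian group `G` and the canonical state `jAmp W N`
(`2 ≤ N`, `2N ≤ |G|`):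
* `sum_jPot` (`Σ_v Φ_v = N(σ)·S`), **product bound** `wsum_occ_emp_product_le`
  (`E[(Σ_occ e^{Φ_u−c})(Σ_emp e^{−(Φ_v−c)})] ≤ E[(|G|−N)N]`, by the move inequality summed over all moves);
* **exponential bounds** `wmean_emp_exp_le` / `wmean_occ_exp_le` (Jensen on one factor + `JastrowEnergyFloor`);
* **soft `L¹` screening** `wmean_sum_abs_pot_le`, `wmean_abs_pot_transl`, `wmean_abs_pot_le`:
  `E_μ|Φ_x − c| ≤ E + 2e^E` uniformly in `|G|` and `x`;
* **Onsager's lemma** `jastrowEnergyFloor_of_psd`: `KernelPSDShift W D`, `D ≥ 0` ⟹ `JastrowEnergyFloor W N D`.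
-/

set_option linter.dupNamespace false

noncomputable section

open Finset

namespace Summit.HubbardSuperconductivity.HubbardSuperconductivity.Theorems.AnisotropyChord.InsertionEntropy

section JastrowScreening

variable {G : Type} [AddCommGroup G] [Fintype G] [DecidableEq G]

omit [DecidableEq G] in
/-- `Σ_v Φ_v(σ) = N(σ) · S`. (theory seat Sketch9 Part P `sum_sheetPotential`) [folklore] -/
theorem sum_jPot (W : G → ℝ) (σ : G → Fin 2) : ∑ v, jPot W v σ = (particleCount σ : ℝ) * kernelMass W := by
  unfold jPot kernelMass
  rw [Finset.sum_comm]
  have h : ∀ z : G, ∑ v, W (z - v) * occ σ z = occ σ z * ∑ t, W t := by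
    intro z
    rw [Finset.mul_sum, ← Equiv.sum_comp (Equiv.subLeft z) (fun t => occ σ z * W t)]
    exact Finset.sum_congr rfl fun v _ => by rw [Equiv.subLeft_apply, mul_comm]
  rw [Finset.sum_congr rfl fun z _ => h z, ← Finset.sum_mul, sum_occ_eq_particleCount]

/-- On the support of `jAmp W N`: `Σ_v (1 − n_v) = |G| − N`. [folklore] -/
theorem sum_one_sub_occ_jAmp (W : G → ℝ) (N : ℕ) (σ : G → Fin 2) (h : jAmp W N σ ≠ 0) :
    ∑ v, (1 - occ σ v) = (Fintype.card G : ℝ) - N := by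
  rw [Finset.sum_sub_distrib, sum_occ_jAmp W N σ h, Finset.sum_const, Finset.card_univ, nsmul_eq_mul, mul_one]

/-- **PRODUCT BOUND (resampling):** `E[(Σ_occ e^{Φ_u − c})(Σ_emp e^{−(Φ_v − c)})] ≤ E[(|G| − N) N]` as weighted sums.
(theory seat Sketch9 Part P `wsum_occ_emp_product_le`) [folklore] -/
theorem wsum_occ_emp_product_le (W : G → ℝ) (hWe : ∀ z, W (-z) = W z) (hW0 : W 0 = 0) (hWnn : ∀ z, 0 ≤ W z)
    (N : ℕ) (c : ℝ) :
    wsum (jAmp W N) (fun σ => (∑ u, occ σ u * Real.exp (jPot W u σ - c))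
        * (∑ v, (1 - occ σ v) * Real.exp (-(jPot W v σ - c))))
      ≤ wsum (jAmp W N) (fun σ => (∑ u, (1 - occ σ u)) * (∑ v, occ σ v)) := by
  unfold wsum
  have hl : ∀ σ : G → Fin 2,
      (∑ u, occ σ u * Real.exp (jPot W u σ - c)) * (∑ v, (1 - occ σ v) * Real.exp (-(jPot W v σ - c)))
      = ∑ u, ∑ v, occ σ u * (1 - occ σ v) * Real.exp (jPot W u σ - jPot W v σ) := by
    intro σ
    rw [Finset.sum_mul_sum]
    refine Finset.sum_congr rfl fun u _ => Finset.sum_congr rfl fun v _ => ?_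
    rw [show jPot W u σ - jPot W v σ = (jPot W u σ - c) + (-(jPot W v σ - c)) by ring, Real.exp_add]
    ring
  have hr : ∀ σ : G → Fin 2, (∑ u, (1 - occ σ u)) * (∑ v, occ σ v) = ∑ u, ∑ v, (1 - occ σ u) * occ σ v := by
    intro σ; rw [Finset.sum_mul_sum]
  simp_rw [hl, hr, Finset.mul_sum]
  rw [Finset.sum_comm]
  conv_rhs => rw [Finset.sum_comm]
  refine Finset.sum_le_sum fun u _ => ?_
  rw [Finset.sum_comm]
  conv_rhs => rw [Finset.sum_comm]
  refine Finset.sum_le_sum fun v _ => ?_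
  exact wsum_move_term_le W hWe hW0 hWnn N u v

/-- **HOLE-SIDE EXPONENTIAL BOUND:** `E[Σ_emp e^{−(Φ_v − c)}] ≤ (|G| − N) e^{E}` (Jensen on the occupied factor + energy
floor). (theory seat Sketch9 Part P `mean_emp_exp_le`) [folklore] -/
theorem wmean_emp_exp_le (W : G → ℝ) (hWe : ∀ z, W (-z) = W z) (hW0 : W 0 = 0) (hWnn : ∀ z, 0 ≤ W z)
    (N : ℕ) {E : ℝ} (hN2 : 2 ≤ N) (h2N : 2 * N ≤ Fintype.card G) (hEF : JastrowEnergyFloor W N E) :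
    wmean (jAmp W N) (fun σ => ∑ v, (1 - occ σ v) * Real.exp (-(jPot W v σ - jMeanPot W N)))
      ≤ ((Fintype.card G : ℝ) - N) * Real.exp E := by
  have hZ1 : wnorm (jAmp W N) = 1 := wnorm_jAmp W N (by omega)
  have hZpos : 0 < wnorm (jAmp W N) := by rw [hZ1]; exact one_pos
  have hZ : wnorm (jAmp W N) ≠ 0 := hZpos.ne'
  have hN2r : (2 : ℝ) ≤ (N : ℝ) := by exact_mod_cast hN2
  have hNV : 2 * (N : ℝ) ≤ (Fintype.card G : ℝ) := by exact_mod_cast h2N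
  set F : (G → Fin 2) → ℝ := fun σ => ∑ u, occ σ u * Real.exp (jPot W u σ - jMeanPot W N) with hF
  set Gf : (G → Fin 2) → ℝ := fun σ => ∑ v, (1 - occ σ v) * Real.exp (-(jPot W v σ - jMeanPot W N)) with hG
  have hG0 : ∀ σ, 0 ≤ Gf σ := fun σ =>
    Finset.sum_nonneg fun v _ => mul_nonneg (by linarith [(occ_mem_unit σ v).2]) (Real.exp_pos _).le
  -- Jensen + floor on the support: F ≥ N e^{−E}
  have hFlow : ∀ σ, jAmp W N σ ≠ 0 → (N : ℝ) * Real.exp (-E) ≤ F σ := by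
    intro σ hσ
    have hpc := jAmp_support W N σ hσ
    have hsumN : ∑ u, occ σ u = (N : ℝ) := sum_occ_jAmp W N σ hσ
    have hJ := mass_mul_exp_avg_le (fun u => occ σ u) (fun u => jPot W u σ - jMeanPot W N)
      (N : ℝ) (by linarith) (fun u => (occ_mem_unit σ u).1) hsumN
    have hfl := hEF σ hpc
    have havg : -E ≤ (∑ u, occ σ u * (jPot W u σ - jMeanPot W N)) / (N : ℝ) := by
      rw [le_div_iff₀ (by linarith)]
      have : ∑ u, occ σ u * (jPot W u σ - jMeanPot W N)
          = ∑ u, occ σ u * jPot W u σ - jMeanPot W N * ∑ u, occ σ u := by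
        rw [Finset.mul_sum, ← Finset.sum_sub_distrib]; exact Finset.sum_congr rfl fun u _ => by ring
      rw [this, hsumN]; nlinarith
    calc (N : ℝ) * Real.exp (-E)
        ≤ (N : ℝ) * Real.exp ((∑ u, occ σ u * (jPot W u σ - jMeanPot W N)) / (N : ℝ)) :=
          mul_le_mul_of_nonneg_left (Real.exp_le_exp.mpr havg) (by linarith)
      _ ≤ F σ := hJ
  -- product bound in mean form
  have hprod : wmean (jAmp W N) (fun σ => F σ * Gf σ) ≤ ((Fintype.card G : ℝ) - N) * N := by
    have h1 := wsum_occ_emp_product_le W hWe hW0 hWnn N (jMeanPot W N)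
    have h2 : wmean (jAmp W N) (fun σ => (∑ u, (1 - occ σ u)) * (∑ v, occ σ v))
        = ((Fintype.card G : ℝ) - N) * N := by
      rw [wmean_congr_support (jAmp W N) (g := fun _ => ((Fintype.card G : ℝ) - N) * N) ?_, wmean_const _ _ hZ]
      intro σ hσ
      rw [sum_one_sub_occ_jAmp W N σ hσ, sum_occ_jAmp W N σ hσ]
    rw [← h2]
    unfold wmean
    exact div_le_div_of_nonneg_right h1 hZpos.le
  have hlow : wmean (jAmp W N) (fun σ => (N : ℝ) * Real.exp (-E) * Gf σ) ≤ wmean (jAmp W N) (fun σ => F σ * Gf σ) :=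
    wmean_mono_support _ fun σ hσ => mul_le_mul_of_nonneg_right (hFlow σ hσ) (hG0 σ)
  rw [wmean_smul] at hlow
  have hNe : 0 < (N : ℝ) * Real.exp (-E) := mul_pos (by linarith) (Real.exp_pos _)
  have hmG : wmean (jAmp W N) Gf * ((N : ℝ) * Real.exp (-E)) ≤ ((Fintype.card G : ℝ) - N) * N := by
    linarith [hlow.trans hprod]
  rw [← le_div_iff₀ hNe] at hmG
  calc wmean (jAmp W N) Gf ≤ ((Fintype.card G : ℝ) - N) * N / ((N : ℝ) * Real.exp (-E)) := hmG
    _ = ((Fintype.card G : ℝ) - N) * Real.exp E := by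
        rw [div_eq_iff hNe.ne']
        calc ((Fintype.card G : ℝ) - N) * N
            = ((Fintype.card G : ℝ) - N) * N * (Real.exp E * Real.exp (-E)) := by
              rw [← Real.exp_add, add_neg_cancel, Real.exp_zero, mul_one]
          _ = ((Fintype.card G : ℝ) - N) * Real.exp E * ((N : ℝ) * Real.exp (-E)) := by ring

omit [DecidableEq G] in
/-- Bookkeeping on the sector: `Σ_v (1 − n_v)(Φ_v − c) = N c − Σ_v n_v Φ_v` (`Σ_v Φ_v = N S`, `|G| c = N S`).
(theory seat Sketch9 Part P `sum_emp_pot_sub_eq`) [folklore] -/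
theorem sum_emp_pot_sub_eq (W : G → ℝ) (N : ℕ) (σ : G → Fin 2) (hpc : particleCount σ = N)
    (hG : 0 < Fintype.card G) :
    ∑ v, (1 - occ σ v) * (jPot W v σ - jMeanPot W N) = (N : ℝ) * jMeanPot W N - ∑ v, occ σ v * jPot W v σ := by
  have hV0 : (Fintype.card G : ℝ) ≠ 0 := by exact_mod_cast hG.ne'
  have hVc : (Fintype.card G : ℝ) * jMeanPot W N = (N : ℝ) * kernelMass W := by
    unfold jMeanPot; field_simp
  have hsumN : ∑ u, occ σ u = (N : ℝ) := by rw [sum_occ_eq_particleCount, hpc]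
  have hsumΦ : ∑ v, jPot W v σ = (N : ℝ) * kernelMass W := by rw [sum_jPot, hpc]
  have hterm : ∀ v : G, (1 - occ σ v) * (jPot W v σ - jMeanPot W N)
      = jPot W v σ - jMeanPot W N - occ σ v * jPot W v σ + jMeanPot W N * occ σ v := by
    intro v; ring
  rw [Finset.sum_congr rfl fun v _ => hterm v, Finset.sum_add_distrib, Finset.sum_sub_distrib, Finset.sum_sub_distrib,
    Finset.sum_const, Finset.card_univ, ← Finset.mul_sum, hsumN, hsumΦ]
  simp only [nsmul_eq_mul]
  linarith [hVc]

/-- **PARTICLE-SIDE EXPONENTIAL BOUND:** `E[Σ_occ e^{Φ_u − c}] ≤ N e^{E}` (Jensen on the hole factor + energy floor).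
(theory seat Sketch9 Part P `mean_occ_exp_le`) [folklore] -/
theorem wmean_occ_exp_le (W : G → ℝ) (hWe : ∀ z, W (-z) = W z) (hW0 : W 0 = 0) (hWnn : ∀ z, 0 ≤ W z)
    (N : ℕ) {E : ℝ} (hN2 : 2 ≤ N) (h2N : 2 * N ≤ Fintype.card G) (hE : 0 ≤ E) (hEF : JastrowEnergyFloor W N E) :
    wmean (jAmp W N) (fun σ => ∑ u, occ σ u * Real.exp (jPot W u σ - jMeanPot W N)) ≤ (N : ℝ) * Real.exp E := by
  have hZ1 : wnorm (jAmp W N) = 1 := wnorm_jAmp W N (by omega)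
  have hZpos : 0 < wnorm (jAmp W N) := by rw [hZ1]; exact one_pos
  have hZ : wnorm (jAmp W N) ≠ 0 := hZpos.ne'
  have hN2r : (2 : ℝ) ≤ (N : ℝ) := by exact_mod_cast hN2
  have hNV : 2 * (N : ℝ) ≤ (Fintype.card G : ℝ) := by exact_mod_cast h2N
  have hGpos : 0 < Fintype.card G := by omega
  set F : (G → Fin 2) → ℝ := fun σ => ∑ u, occ σ u * Real.exp (jPot W u σ - jMeanPot W N) with hF
  set Gf : (G → Fin 2) → ℝ := fun σ => ∑ v, (1 - occ σ v) * Real.exp (-(jPot W v σ - jMeanPot W N)) with hG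
  have hF0 : ∀ σ, 0 ≤ F σ := fun σ =>
    Finset.sum_nonneg fun u _ => mul_nonneg (occ_mem_unit σ u).1 (Real.exp_pos _).le
  have hGlow : ∀ σ, jAmp W N σ ≠ 0 → ((Fintype.card G : ℝ) - N) * Real.exp (-E) ≤ Gf σ := by
    intro σ hσ
    have hpc := jAmp_support W N σ hσ
    have hsumH : ∑ v, (1 - occ σ v) = (Fintype.card G : ℝ) - N := sum_one_sub_occ_jAmp W N σ hσ
    have hJ := mass_mul_exp_avg_le (fun v => 1 - occ σ v) (fun v => -(jPot W v σ - jMeanPot W N))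
      ((Fintype.card G : ℝ) - N) (by linarith) (fun v => by linarith [(occ_mem_unit σ v).2]) hsumH
    have hfl := hEF σ hpc
    have hbk := sum_emp_pot_sub_eq W N σ hpc hGpos
    have havg : -E ≤ (∑ v, (1 - occ σ v) * -(jPot W v σ - jMeanPot W N)) / ((Fintype.card G : ℝ) - N) := by
      rw [le_div_iff₀ (by linarith)]
      have : ∑ v, (1 - occ σ v) * -(jPot W v σ - jMeanPot W N)
          = -(∑ v, (1 - occ σ v) * (jPot W v σ - jMeanPot W N)) := by
        rw [← Finset.sum_neg_distrib]; exact Finset.sum_congr rfl fun v _ => by ring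
      rw [this, hbk]
      nlinarith
    calc ((Fintype.card G : ℝ) - N) * Real.exp (-E)
        ≤ ((Fintype.card G : ℝ) - N)
            * Real.exp ((∑ v, (1 - occ σ v) * -(jPot W v σ - jMeanPot W N)) / ((Fintype.card G : ℝ) - N)) :=
          mul_le_mul_of_nonneg_left (Real.exp_le_exp.mpr havg) (by linarith)
      _ ≤ Gf σ := hJ
  have hprod : wmean (jAmp W N) (fun σ => F σ * Gf σ) ≤ ((Fintype.card G : ℝ) - N) * N := by
    have h1 := wsum_occ_emp_product_le W hWe hW0 hWnn N (jMeanPot W N)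
    have h2 : wmean (jAmp W N) (fun σ => (∑ u, (1 - occ σ u)) * (∑ v, occ σ v))
        = ((Fintype.card G : ℝ) - N) * N := by
      rw [wmean_congr_support (jAmp W N) (g := fun _ => ((Fintype.card G : ℝ) - N) * N) ?_, wmean_const _ _ hZ]
      intro σ hσ
      rw [sum_one_sub_occ_jAmp W N σ hσ, sum_occ_jAmp W N σ hσ]
    rw [← h2]
    unfold wmean
    exact div_le_div_of_nonneg_right h1 hZpos.le
  have hlow : wmean (jAmp W N) (fun σ => (((Fintype.card G : ℝ) - N) * Real.exp (-E)) * F σ)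
      ≤ wmean (jAmp W N) (fun σ => F σ * Gf σ) :=
    wmean_mono_support _ fun σ hσ => by
      rw [mul_comm]; exact mul_le_mul_of_nonneg_left (hGlow σ hσ) (hF0 σ)
  rw [wmean_smul] at hlow
  have hNe : 0 < ((Fintype.card G : ℝ) - N) * Real.exp (-E) := mul_pos (by linarith) (Real.exp_pos _)
  have hmF : wmean (jAmp W N) F * (((Fintype.card G : ℝ) - N) * Real.exp (-E)) ≤ ((Fintype.card G : ℝ) - N) * N := by
    linarith [hlow.trans hprod]
  rw [← le_div_iff₀ hNe] at hmF
  calc wmean (jAmp W N) F ≤ ((Fintype.card G : ℝ) - N) * N / (((Fintype.card G : ℝ) - N) * Real.exp (-E)) := hmF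
    _ = (N : ℝ) * Real.exp E := by
        rw [div_eq_iff hNe.ne']
        calc ((Fintype.card G : ℝ) - N) * N
            = ((Fintype.card G : ℝ) - N) * N * (Real.exp E * Real.exp (-E)) := by
              rw [← Real.exp_add, add_neg_cancel, Real.exp_zero, mul_one]
          _ = (N : ℝ) * Real.exp E * (((Fintype.card G : ℝ) - N) * Real.exp (-E)) := by ring

/-- **`L¹` SCREENING (summed form):** `E Σ_v |Φ_v − c| ≤ 2NE + 2(|G| − N)e^E + 2Ne^E`.
(theory seat Sketch9 Part P `mean_sum_abs_pot_le`) [folklore] -/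
theorem wmean_sum_abs_pot_le (W : G → ℝ) (hWe : ∀ z, W (-z) = W z) (hW0 : W 0 = 0) (hWnn : ∀ z, 0 ≤ W z)
    (N : ℕ) {E : ℝ} (hN2 : 2 ≤ N) (h2N : 2 * N ≤ Fintype.card G) (hE : 0 ≤ E) (hEF : JastrowEnergyFloor W N E) :
    wmean (jAmp W N) (fun σ => ∑ v, |jPot W v σ - jMeanPot W N|)
      ≤ 2 * N * E + 2 * (((Fintype.card G : ℝ) - N) * Real.exp E) + 2 * ((N : ℝ) * Real.exp E) := by
  have hA := wmean_emp_exp_le W hWe hW0 hWnn N hN2 h2N hEF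
  have hB := wmean_occ_exp_le W hWe hW0 hWnn N hN2 h2N hE hEF
  have hZ1 : wnorm (jAmp W N) = 1 := wnorm_jAmp W N (by omega)
  have hZ : wnorm (jAmp W N) ≠ 0 := by rw [hZ1]; exact one_ne_zero
  have hGpos : 0 < Fintype.card G := by omega
  have hpt : ∀ σ, jAmp W N σ ≠ 0 →
      ∑ v, |jPot W v σ - jMeanPot W N|
        ≤ 2 * N * E
          + 2 * (∑ v, (1 - occ σ v) * Real.exp (-(jPot W v σ - jMeanPot W N)))
          + 2 * (∑ u, occ σ u * Real.exp (jPot W u σ - jMeanPot W N)) := by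
    intro σ hσ
    have hpc := jAmp_support W N σ hσ
    have hbk := sum_emp_pot_sub_eq W N σ hpc hGpos
    have hfl := hEF σ hpc
    have hsumN : ∑ u, occ σ u = (N : ℝ) := sum_occ_jAmp W N σ hσ
    have hv : ∀ v, |jPot W v σ - jMeanPot W N|
        ≤ (1 - occ σ v) * (jPot W v σ - jMeanPot W N) - occ σ v * (jPot W v σ - jMeanPot W N)
          + 2 * ((1 - occ σ v) * Real.exp (-(jPot W v σ - jMeanPot W N)))
          + 2 * (occ σ v * Real.exp (jPot W v σ - jMeanPot W N)) := by
      intro v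
      have h1 := abs_le_self_add_two_exp_neg (jPot W v σ - jMeanPot W N)
      have h2 := abs_le_neg_add_two_exp (jPot W v σ - jMeanPot W N)
      have hn0 := (occ_mem_unit σ v).1
      have hn1 := (occ_mem_unit σ v).2
      have hsplit : |jPot W v σ - jMeanPot W N|
          = (1 - occ σ v) * |jPot W v σ - jMeanPot W N| + occ σ v * |jPot W v σ - jMeanPot W N| := by ring
      rw [hsplit]
      nlinarith [mul_le_mul_of_nonneg_left h1 (sub_nonneg.mpr hn1), mul_le_mul_of_nonneg_left h2 hn0]
    have hsum := Finset.sum_le_sum fun v (_ : v ∈ Finset.univ) => hv v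
    rw [Finset.sum_add_distrib, Finset.sum_add_distrib, Finset.sum_sub_distrib, ← Finset.mul_sum, ← Finset.mul_sum,
      hbk] at hsum
    have hocc : ∑ v, occ σ v * (jPot W v σ - jMeanPot W N) = ∑ v, occ σ v * jPot W v σ - jMeanPot W N * N := by
      rw [← hsumN, Finset.mul_sum, ← Finset.sum_sub_distrib]; exact Finset.sum_congr rfl fun v _ => by ring
    rw [hocc] at hsum
    nlinarith [hsum, hfl]
  calc wmean (jAmp W N) (fun σ => ∑ v, |jPot W v σ - jMeanPot W N|)
      ≤ wmean (jAmp W N) (fun σ => 2 * N * E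
          + 2 * (∑ v, (1 - occ σ v) * Real.exp (-(jPot W v σ - jMeanPot W N)))
          + 2 * (∑ u, occ σ u * Real.exp (jPot W u σ - jMeanPot W N))) := wmean_mono_support _ hpt
    _ = 2 * N * E
          + 2 * wmean (jAmp W N) (fun σ => ∑ v, (1 - occ σ v) * Real.exp (-(jPot W v σ - jMeanPot W N)))
          + 2 * wmean (jAmp W N) (fun σ => ∑ u, occ σ u * Real.exp (jPot W u σ - jMeanPot W N)) := by
        rw [wmean_add, wmean_add, wmean_smul, wmean_smul, wmean_smul, wmean_const _ _ hZ]
    _ ≤ _ := by nlinarith [hA, hB]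

/-- Translation invariance of the law of the potential at a site. (theory seat Sketch9 Part P `mean_abs_pot_transl`) [folklore] -/
theorem wmean_abs_pot_transl (W : G → ℝ) (N : ℕ) (c : ℝ) (z t : G) :
    wmean (jAmp W N) (fun σ => |jPot W (z + t) σ - c|) = wmean (jAmp W N) (fun σ => |jPot W z σ - c|) := by
  set r : G ≃ G := Equiv.subRight t with hr
  have hinv : ∀ σ, jAmp W N (σ ∘ r) = jAmp W N σ := fun σ =>
    jastrowSectorAmp_comp_equiv _ N r (fun u v => by
      show W (u - t - (v - t)) = W (u - v)
      rw [sub_sub_sub_cancel_right]) σ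
  have hpot : ∀ σ, jPot W (z + t) (σ ∘ r) = jPot W z σ := by
    intro σ
    unfold jPot
    rw [← Equiv.sum_comp r (fun y => W (y - z) * occ σ y)]
    refine Finset.sum_congr rfl fun y _ => ?_
    have ho : occ (σ ∘ r) y = occ σ (r y) := rfl
    rw [ho]
    simp only [hr, Equiv.subRight_apply]
    rw [show y - (z + t) = y - t - z by abel]
  unfold wmean
  congr 1
  unfold wsum
  rw [← Equiv.sum_comp (Equiv.arrowCongr r (Equiv.refl (Fin 2))).symm
    (fun σ => jAmp W N σ ^ 2 * |jPot W (z + t) σ - c|)]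
  refine Finset.sum_congr rfl fun σ _ => ?_
  have e : (Equiv.arrowCongr r (Equiv.refl (Fin 2))).symm σ = σ ∘ r := by
    ext u; simp [Equiv.arrowCongr]
  rw [e, hinv, hpot]

/-- **`L¹` SCREENING AT A SITE (PROVED):** `E_μ |Φ_x − c| ≤ E + 2e^{E}`, uniformly in `|G|` and `x`, from the energy
floor alone (`W ≥ 0` even, `W 0 = 0`, `2 ≤ N`, `2N ≤ |G|`). (theory seat Sketch9 Part P `mean_abs_pot_le`) [folklore] -/
theorem wmean_abs_pot_le (W : G → ℝ) (hWe : ∀ z, W (-z) = W z) (hW0 : W 0 = 0) (hWnn : ∀ z, 0 ≤ W z)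
    (N : ℕ) {E : ℝ} (hN2 : 2 ≤ N) (h2N : 2 * N ≤ Fintype.card G) (hE : 0 ≤ E) (hEF : JastrowEnergyFloor W N E)
    (x : G) :
    wmean (jAmp W N) (fun σ => |jPot W x σ - jMeanPot W N|) ≤ E + 2 * Real.exp E := by
  have hN2r : (2 : ℝ) ≤ (N : ℝ) := by exact_mod_cast hN2
  have hNV : 2 * (N : ℝ) ≤ (Fintype.card G : ℝ) := by exact_mod_cast h2N
  have hconst : ∀ v : G, wmean (jAmp W N) (fun σ => |jPot W v σ - jMeanPot W N|)
      = wmean (jAmp W N) (fun σ => |jPot W x σ - jMeanPot W N|) := by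
    intro v
    have := wmean_abs_pot_transl W N (jMeanPot W N) x (v - x)
    rwa [add_sub_cancel] at this
  have hsum : (Fintype.card G : ℝ) * wmean (jAmp W N) (fun σ => |jPot W x σ - jMeanPot W N|)
      = wmean (jAmp W N) (fun σ => ∑ v, |jPot W v σ - jMeanPot W N|) := by
    rw [wmean_finset_sum, Finset.sum_congr rfl fun v _ => hconst v, Finset.sum_const, Finset.card_univ]
    simp
  have hb := wmean_sum_abs_pot_le W hWe hW0 hWnn N hN2 h2N hE hEF
  rw [← hsum] at hb
  have hV : (0 : ℝ) < (Fintype.card G : ℝ) := by linarith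
  rw [← sub_nonneg]
  have : (Fintype.card G : ℝ) * (E + 2 * Real.exp E - wmean (jAmp W N) (fun σ => |jPot W x σ - jMeanPot W N|))
      ≥ 0 := by nlinarith [Real.exp_pos E]
  nlinarith

/-! ### Onsager's lemma: PSD ⟹ energy floor -/

omit [DecidableEq G] in
/-- Row sums of a difference kernel: `Σ_v W(u − v) = S`. [folklore] -/
theorem sum_kernel_sub_left (W : G → ℝ) (u : G) : ∑ v, W (u - v) = kernelMass W := by
  unfold kernelMass
  rw [← Equiv.sum_comp (Equiv.subLeft u) (fun t => W t)]
  simp only [Equiv.subLeft_apply]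

omit [DecidableEq G] in
/-- Column sums of a difference kernel: `Σ_u W(u − v) = S`. [folklore] -/
theorem sum_kernel_sub_right (W : G → ℝ) (v : G) : ∑ u, W (u - v) = kernelMass W := by
  unfold kernelMass
  rw [← Equiv.sum_comp (Equiv.subRight v) (fun t => W t)]
  simp only [Equiv.subRight_apply]

omit [DecidableEq G] in
/-- **ONSAGER'S LEMMA (PROVED):** PSD of `W + Dδ` with `D ≥ 0` ⟹ the energy floor with `E = D`, by testing the form on
`f = n − ρ·1`, `ρ = N/|G|`. (theory seat Sketch9 Part P `sheetEnergyFloor_of_PSD`, generalised) [folklore] -/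
theorem jastrowEnergyFloor_of_psd (W : G → ℝ) (hWe : ∀ z, W (-z) = W z) (N : ℕ) (D : ℝ) (hD : 0 ≤ D)
    (hG : 0 < Fintype.card G) (h : KernelPSDShift W D) : JastrowEnergyFloor W N D := by
  intro σ hpc
  have hV : (0 : ℝ) < (Fintype.card G : ℝ) := by exact_mod_cast hG
  have hsumN : ∑ u, occ σ u = (N : ℝ) := by rw [sum_occ_eq_particleCount, hpc]
  have hN0 : (0 : ℝ) ≤ (N : ℝ) := by positivity
  set ρ : ℝ := (N : ℝ) / (Fintype.card G : ℝ) with hρ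
  have hρ0 : 0 ≤ ρ := div_nonneg hN0 hV.le
  have hρV : ρ * (Fintype.card G : ℝ) = N := by rw [hρ]; field_simp
  have hmp : jMeanPot W N = ρ * kernelMass W := by rw [hρ]; unfold jMeanPot; ring
  have ha : ∑ u, ∑ v, occ σ u * occ σ v * W (u - v) = ∑ u, occ σ u * jPot W u σ := by
    refine Finset.sum_congr rfl fun u _ => ?_
    unfold jPot
    rw [Finset.mul_sum]
    refine Finset.sum_congr rfl fun v _ => ?_
    rw [← hWe (v - u), neg_sub]
    ring
  have hb : ∑ u, ∑ v, occ σ u * W (u - v) = (N : ℝ) * kernelMass W := by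
    rw [Finset.sum_congr rfl fun u _ => by rw [← Finset.mul_sum, sum_kernel_sub_left W u], ← Finset.sum_mul, hsumN]
  have hc : ∑ u, ∑ v, occ σ v * W (u - v) = (N : ℝ) * kernelMass W := by
    rw [Finset.sum_comm, Finset.sum_congr rfl fun v _ => by rw [← Finset.mul_sum, sum_kernel_sub_right W v],
      ← Finset.sum_mul, hsumN]
  have hd : ∑ u, ∑ v, W (u - v) = (Fintype.card G : ℝ) * kernelMass W := by
    rw [Finset.sum_congr rfl fun u _ => sum_kernel_sub_left W u, Finset.sum_const, Finset.card_univ]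
    simp
  have he : ∑ u, (occ σ u - ρ) ^ 2 = (N : ℝ) - 2 * ρ * N + ρ ^ 2 * (Fintype.card G : ℝ) := by
    have : ∀ u, (occ σ u - ρ) ^ 2 = occ σ u - 2 * ρ * occ σ u + ρ ^ 2 := by
      intro u; have := occ_mul_self σ u; nlinarith [this]
    rw [Finset.sum_congr rfl fun u _ => this u, Finset.sum_add_distrib, Finset.sum_sub_distrib, Finset.sum_const,
      Finset.card_univ, ← Finset.mul_sum, hsumN]
    simp; ring
  have hexp : ∑ u, ∑ v, (occ σ u - ρ) * (occ σ v - ρ) * W (u - v)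
      = ∑ u, ∑ v, occ σ u * occ σ v * W (u - v)
        - ρ * ∑ u, ∑ v, occ σ u * W (u - v)
        - ρ * ∑ u, ∑ v, occ σ v * W (u - v)
        + ρ ^ 2 * ∑ u, ∑ v, W (u - v) := by
    simp only [Finset.mul_sum, ← Finset.sum_sub_distrib, ← Finset.sum_add_distrib]
    refine Finset.sum_congr rfl fun u _ => Finset.sum_congr rfl fun v _ => ?_
    ring
  have h0 := h (fun u => occ σ u - ρ)
  rw [hexp, ha, hb, hc, hd, he] at h0
  have h1 : ρ ^ 2 * (Fintype.card G : ℝ) = ρ * N := by rw [pow_two, mul_assoc, hρV]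
  have h2 : ρ ^ 2 * ((Fintype.card G : ℝ) * kernelMass W) = ρ * N * kernelMass W := by rw [← mul_assoc, h1]
  rw [h2, h1] at h0
  rw [hmp]
  nlinarith [h0, mul_nonneg (mul_nonneg hD hρ0) hN0]

end JastrowScreening

end Summit.HubbardSuperconductivity.HubbardSuperconductivity.Theorems.AnisotropyChord.InsertionEntropy
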